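import Literature.MathematicalPhysics.QuantumFieldTheory.Balaban1983to89.T4InputCauchyRateTermwise

/-!
# NE5 ∕ U3 — row O1-d3 of the O1 claim table, GENERIC HALF: `TermRep` on a class IS «the output is the series of its
# terms» plus the displayed termwise majorant (claim table `t4/b2b-balaban-t4-ne5-p1/O1-CLAIM-TABLE-NE5-P1.md` row O1-d,
# part d3; skeleton `t4/b2b-balaban-t4-ne5-p1/SKELETON-NE5-P1.md` §4 O1∕O2)

Cell `pub-balaban`, unit `b2b-balaban-t4-ne5-formalise-leaf-04` (NE5 formalisation swarm, LEAF PROVER 04; trigger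
`t4/T4-NE5-TRIGGER.json`, t4-ref2 pass 58).  Summits-side new work under the LEAN PLACEMENT RULE (cell bookkeeping; NOT a
Literature module).  HONEST FRAMING: rung (B)+1 of the FINITE-VOLUME T⁴ continuum programme — NOT infinite volume, NOT a
mass gap, NOT the Clay problem, NOT a proof of NE5 (NOT PRINTED in [Balaban1987RG1]–[Balaban1989LargeFieldII]; they print
ε-UNIFORM bounds, never η-RATES).  HONEST DEPENDENCY (cell line, verbatim): continuum YM on T⁴ ⇐ BetaPertH ∧ nine spine
estimates (0/9 proved); BetaPertH ⇐ (D1) ∧ (D4) ∧ CAP+tail; G-an2-4 gates asym, D1 and NE2/3/4.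

WHAT THIS FILE DOES.  Row O1-d of the claim table types Bałaban's one-step output functional ([Balaban1988RG2Cluster] (2.13)
p. 14, (2.9) p. 14, (2.14) p. 15) as the SUM of a term family `T k i` and asks, as its third part d3, for the hypothesis shape
`T4InputCauchyRateTermwise.TermRep M K T W` («at every class point the step-`k` output at a step-`k` domain is the `HasSum` of
its terms») as a THEOREM for the model's own class.  The row's design (owner's `B13StepDesign.md` §3 O1-d, RULE R1) DEFINES
`Out := ∑' i, T k i`.  This file isolates the generic content of d3, with no estimate anywhere:
* §1 the IDENTIFICATION shapes `OutIsSeries M T` (everywhere) ∕ `OutIsSeriesOn M T K W` (at class points, step-`k` domains):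
  «`M.Out k o h X = ∑' i, T k i o h X`» — what part d2 delivers by `rfl` for `Out := seriesOut T`
  (`outIsSeries_of_out_eq_seriesOut`); and the converse `outIsSeriesOn_of_termRep` (`HasSum.tsum_eq`): `TermRep` already
  contains the identification;
* §2 THE d3 THEOREM, generic: `OutIsSeriesOn ∧ TermBound K T W κ a ∧ (∀ k, Summable (a k)) ⟹ TermRep M K T W`
  (`termRep_of_outIsSeriesOn`; comparison test `Summable.of_norm_bounded` + `Summable.hasSum`), the `TermBudget a G` form
  (`termRep_of_outIsSeriesOn_budget`), and the equivalence `termRep_iff_outIsSeriesOn` under the displayed majorant — so for a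
  model whose `Out` IS the series, d3 reduces EXACTLY to the displayed convergence hypotheses `TermBound`∕`TermBudget` of the
  termwise leaf (printed SUPPORT, LOCATORS ONLY, trigger c3∕c4: [Balaban1988RG2Cluster] Lemma 3 (2.38) p. 20, (2.39)–(2.41)
  p. 21, p. 20 *"sufficient conditions for convergence of the series (2.12), (2.13) are satisfied"*; NOT minted as facts here
  and NOT asserted for Bałaban's terms);
* §3 FINITE term families (route P2's `ActivityTermModel.TermFamily` reads activities as FINITE sums): `Out = Σ_{i∈s} T k i`
  with the terms vanishing off `s` ⟹ `TermRep` with NO convergence hypothesis (`termRep_of_outIsFinsetSumOn`,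
  `termRep_of_outIsSumOn` for `[Fintype ι]`);
* §4 COMPOSITION BY NAME with the landed closures: `classBound_of_outIsSeriesOn` (= `classBound_of_termwise`) and the END
  face `ne5_at_of_stepModel_series_slack_budget_scale_nat` (= `T4InputCauchyRateTermwise.ne5_at_of_stepModel_termwise_slack_
  budget_scale_nat` with `hrep` DISCHARGED from `OutIsSeriesOn`; every other binder BY NAME and unchanged; conclusion
  literally `T4OutputRate.NE5 EA EB W κ θ′ C₅`);
* §5 CONSISTENCY CHECK on the termwise leaf's toy (`toyModelER`, `toyTermE`, index type `ℕ`, a genuinely infinite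
  expansion): `OutIsSeries` holds (`toyER_outIsSeries`) and §2 re-derives the leaf's `toyE_termRep` from the leaf's own
  `toyE_termBound`∕`toyE_termBudget` (two `example`s — the statement is the leaf's, so no new declaration).
CONSEQUENCE for the swarm: part d3-ii for `B13Step` is the one-liner `termRep_of_outIsSeriesOn (outIsSeriesOn_of_outIsSeries
(outIsSeries_of_out_eq_seriesOut rfl)) hbd hsum` once parts d1 (index types, leaf-02) and d2 (term definitions with
`Out := ∑' i, T k i`, leaf-08) land; the convergence binders stay DISPLAYED (they are leaf O2's termwise data, not d3's).
STATUS: every hypothesis is an IDENTIFICATION (`OutIsSeries*`) or a displayed hypothesis SHAPE of the landed termwise leaf;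
nothing of the manuscripts under audit is asserted; they are cited for KIND∕locus only.  0 sorry; no new axioms.
-/

namespace Summit.QuantumFields.BalabanUV.T4Continuum.TermRepOfSeries

open Metric
open scoped BigOperators Topology

open Literature.MathematicalPhysics.QuantumFieldTheory.Balaban1983to89.T4OutputRate (Carriers Functional DecayBound NE5)
open Literature.MathematicalPhysics.QuantumFieldTheory.Balaban1983to89.T4InputCauchyRateData (StepModel)
open Literature.MathematicalPhysics.QuantumFieldTheory.Balaban1983to89.T4InputCauchyRateSpecies
  (ClassBound ballClass BaseBudget)
open Literature.MathematicalPhysics.QuantumFieldTheory.Balaban1983to89.T4InputCauchyRateTermwise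
  (TermRep TermBound TermBudget TermLineAnalytic classBound_of_termwise ne5_at_of_stepModel_termwise_slack_budget_scale_nat)

variable {C : Carriers} {Op Hist : Type*} [NormedAddCommGroup Op] [NormedSpace ℂ Op] [NormedAddCommGroup Hist]
  [NormedSpace ℂ Hist] {ι : Type*}

/-! ## §1 The identification shapes: the output IS the series of its terms -/

section Identification

variable (M : StepModel C Op Hist) (T : ℕ → ι → Op → Hist → C.Dom → ℂ)

/-- [folklore] The SERIES OUTPUT of a term family: `(k, o, h, X) ↦ ∑' i, T k i o h X` (unconditional sum; `0` where the family
is not summable — Mathlib's `tsum` convention, irrelevant wherever `TermRep` is used since there the sum converges).  The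
design's `Out := ∑' i, T k i` (owner's `B13StepDesign.md` §3 O1-d, RULE R1: one `Out` for both runs, no η inside). -/
noncomputable def seriesOut : ℕ → Op → Hist → C.Dom → ℂ := fun k o h X => ∑' i, T k i o h X

/-- [folklore] IDENTIFICATION SHAPE `OutIsSeries M T`: at EVERY input point the model's step-`k` output is the series of the
term family (printed KIND: [Balaban1988RG2Cluster] (2.13) p. 14 DEFINES `𝐄^{(k+1)}(X)` by its expansion; nothing asserted
about Bałaban's terms here).  No inequality inside. -/
def OutIsSeries : Prop := ∀ (k : ℕ) (o : Op) (h : Hist) (X : C.Dom), M.Out k o h X = ∑' i, T k i o h X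

/-- [folklore] IDENTIFICATION SHAPE `OutIsSeriesOn M T K W`: the same, asked only where `TermRep` asks it — at the points of the
input class `K k g U` (couplings in the window `W`) and at step-`k` domains. -/
def OutIsSeriesOn (K : ℕ → (ℕ → ℝ) → C.BgB → Set (Op × Hist)) (W : Set (ℕ → ℝ)) : Prop :=
  ∀ k, ∀ g ∈ W, ∀ (U : C.BgB) (q : Op × Hist), q ∈ K k g U → ∀ X : C.Dom, C.scale X = k →
    M.Out k q.1 q.2 X = ∑' i, T k i q.1 q.2 X

variable {M T}

/-- [folklore] A model whose output field IS `seriesOut T` satisfies `OutIsSeries` by `rfl` — the form in which part d2 of row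
O1-d delivers the identification. -/
theorem outIsSeries_of_out_eq_seriesOut (h : M.Out = seriesOut T) : OutIsSeries M T := fun k o h' X => by
  rw [h]; rfl

/-- [folklore] Everywhere ⟹ on any class. -/
theorem outIsSeriesOn_of_outIsSeries (h : OutIsSeries M T) (K : ℕ → (ℕ → ℝ) → C.BgB → Set (Op × Hist))
    (W : Set (ℕ → ℝ)) : OutIsSeriesOn M T K W := fun k _ _ _ q _ X _ => h k q.1 q.2 X

/-- [folklore] Class monotonicity: the identification on a class restricts to any smaller class and smaller window. -/
theorem OutIsSeriesOn.mono {K K' : ℕ → (ℕ → ℝ) → C.BgB → Set (Op × Hist)} {W W' : Set (ℕ → ℝ)}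
    (h : OutIsSeriesOn M T K W) (hK : ∀ k g U, K' k g U ⊆ K k g U) (hW : W' ⊆ W) : OutIsSeriesOn M T K' W' :=
  fun k g hg U q hq X hX => h k g (hW hg) U q (hK k g U hq) X hX

/-- [folklore] THE CONVERSE: `TermRep` CONTAINS the identification — a `HasSum` determines the `tsum` (`HasSum.tsum_eq`).  So on a
class, «`Out` is the series of the `T k i`» is not an extra hypothesis of the termwise route but a consequence of `TermRep`. -/
theorem outIsSeriesOn_of_termRep {K : ℕ → (ℕ → ℝ) → C.BgB → Set (Op × Hist)} {W : Set (ℕ → ℝ)}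
    (hrep : TermRep M K T W) : OutIsSeriesOn M T K W :=
  fun k g hg U q hq X hX => ((hrep k g hg U q hq X hX).tsum_eq).symm

end Identification

/-! ## §2 The d3 theorem, generic: identification + displayed termwise majorant ⟹ `TermRep` -/

section Series

variable {M : StepModel C Op Hist} {T : ℕ → ι → Op → Hist → C.Dom → ℂ}
  {K : ℕ → (ℕ → ℝ) → C.BgB → Set (Op × Hist)} {W : Set (ℕ → ℝ)}

omit [NormedAddCommGroup Op] [NormedSpace ℂ Op] [NormedAddCommGroup Hist] [NormedSpace ℂ Hist] in
/-- [folklore] COMPARISON TEST at a class point: under the displayed termwise majorant `TermBound K T W κ a` with summable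
weights `a k`, the term family at a class point and a step-`k` domain is (absolutely) summable
(`Summable.of_norm_bounded` against `i ↦ a k i · e^{−κd(X)}`). -/
theorem summable_terms_of_termBound {κ : ℝ} {a : ℕ → ι → ℝ} (hbd : TermBound K T W κ a) (ha : ∀ k, Summable (a k))
    {k : ℕ} {g : ℕ → ℝ} (hg : g ∈ W) (U : C.BgB) {q : Op × Hist} (hq : q ∈ K k g U) {X : C.Dom}
    (hX : C.scale X = k) : Summable fun i => T k i q.1 q.2 X :=
  Summable.of_norm_bounded ((ha k).mul_right (Real.exp (-(κ * C.d X)))) fun i => hbd k g hg U q hq X hX i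

/-- [folklore] **ROW O1-d3, GENERIC FORM.**  If the model's output is the series of its terms on the class (`OutIsSeriesOn`)
and the terms carry the displayed majorant `TermBound K T W κ a` with summable weights, then `TermRep M K T W`: at every
class point the output is the `HasSum` of its terms (`Summable.hasSum` + the identification).  The convergence binders are
the termwise leaf's displayed hypothesis shapes (printed SUPPORT [Balaban1988RG2Cluster] Lemma 3 (2.38) p. 20, (2.41) p. 21
— locators only); nothing is asserted about Bałaban's expansion. -/
theorem termRep_of_outIsSeriesOn {κ : ℝ} {a : ℕ → ι → ℝ} (hout : OutIsSeriesOn M T K W) (hbd : TermBound K T W κ a)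
    (ha : ∀ k, Summable (a k)) : TermRep M K T W := by
  intro k g hg U q hq X hX
  rw [hout k g hg U q hq X hX]
  exact (summable_terms_of_termBound hbd ha hg U hq hX).hasSum

/-- [folklore] The same with the weights' summability read from the termwise leaf's `TermBudget a G` (its first conjunct;
the budget `∑' a k ≤ G` itself is not used by d3 — it is O2's). -/
theorem termRep_of_outIsSeriesOn_budget {κ G : ℝ} {a : ℕ → ι → ℝ} (hout : OutIsSeriesOn M T K W)
    (hbd : TermBound K T W κ a) (hbud : TermBudget a G) : TermRep M K T W :=
  termRep_of_outIsSeriesOn hout hbd fun k => (hbud k).1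

/-- [folklore] The everywhere-identification form (what `Out := seriesOut T` gives): `OutIsSeries ∧ TermBound ∧ TermBudget ⟹
TermRep` on ANY class carrying the majorant. -/
theorem termRep_of_outIsSeries_budget {κ G : ℝ} {a : ℕ → ι → ℝ} (hout : OutIsSeries M T) (hbd : TermBound K T W κ a)
    (hbud : TermBudget a G) : TermRep M K T W :=
  termRep_of_outIsSeriesOn_budget (outIsSeriesOn_of_outIsSeries hout K W) hbd hbud

/-- [folklore] For a model BUILT with `Out := seriesOut T` (part d2's form), `TermRep` on a class is EXACTLY the displayed
convergence data on that class: `TermBound ∧ (Σ a k < ∞) ⟹ TermRep`. -/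
theorem termRep_of_out_eq_seriesOut {κ : ℝ} {a : ℕ → ι → ℝ} (h : M.Out = seriesOut T) (hbd : TermBound K T W κ a)
    (ha : ∀ k, Summable (a k)) : TermRep M K T W :=
  termRep_of_outIsSeriesOn (outIsSeriesOn_of_outIsSeries (outIsSeries_of_out_eq_seriesOut h) K W) hbd ha

/-- [folklore] **EQUIVALENCE under the displayed majorant**: given `TermBound K T W κ a` with summable weights, `TermRep M K T W
↔ OutIsSeriesOn M T K W` — the representation hypothesis of the termwise route IS the identification «the output is the
series of its terms», no more and no less (`outIsSeriesOn_of_termRep` ∕ `termRep_of_outIsSeriesOn`). -/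
theorem termRep_iff_outIsSeriesOn {κ : ℝ} {a : ℕ → ι → ℝ} (hbd : TermBound K T W κ a) (ha : ∀ k, Summable (a k)) :
    TermRep M K T W ↔ OutIsSeriesOn M T K W :=
  ⟨outIsSeriesOn_of_termRep, fun hout => termRep_of_outIsSeriesOn hout hbd ha⟩

/-- [folklore] Under `TermRep` the series output and the model's output AGREE on the class (so replacing a represented
model's `Out` by `seriesOut T` changes nothing where the route reads it). -/
theorem seriesOut_eq_out_of_termRep (hrep : TermRep M K T W) {k : ℕ} {g : ℕ → ℝ} (hg : g ∈ W) (U : C.BgB)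
    {q : Op × Hist} (hq : q ∈ K k g U) {X : C.Dom} (hX : C.scale X = k) :
    seriesOut T k q.1 q.2 X = M.Out k q.1 q.2 X :=
  (hrep k g hg U q hq X hX).tsum_eq

end Series

/-! ## §3 Finite term families: no convergence hypothesis -/

section Finite

variable {M : StepModel C Op Hist} {T : ℕ → ι → Op → Hist → C.Dom → ℂ}
  {K : ℕ → (ℕ → ℝ) → C.BgB → Set (Op × Hist)} {W : Set (ℕ → ℝ)}

/-- [folklore] IDENTIFICATION SHAPE, FINITE FORM `OutIsFinsetSumOn M T s K W`: on the class, the step-`k` output at a step-`k`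
domain `X` is the FINITE sum of its terms over `s k X`, and the terms outside `s k X` vanish there (one index type for all
steps and domains, the terms irrelevant to `(k, X)` being zero — the convention of `TermRep`'s docstring).  Route P2's
`ActivityTermModel.TermFamily` reads activities this way (`terms … : Finset J`). -/
def OutIsFinsetSumOn (M : StepModel C Op Hist) (T : ℕ → ι → Op → Hist → C.Dom → ℂ) (s : ℕ → C.Dom → Finset ι)
    (K : ℕ → (ℕ → ℝ) → C.BgB → Set (Op × Hist)) (W : Set (ℕ → ℝ)) : Prop :=
  ∀ k, ∀ g ∈ W, ∀ (U : C.BgB) (q : Op × Hist), q ∈ K k g U → ∀ X : C.Dom, C.scale X = k →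
    M.Out k q.1 q.2 X = ∑ i ∈ s k X, T k i q.1 q.2 X ∧ ∀ i ∉ s k X, T k i q.1 q.2 X = 0

/-- [folklore] **FINITE FAMILIES ⟹ `TermRep` UNCONDITIONALLY** (`hasSum_sum_of_ne_finset_zero`): a finite expansion needs no
majorant to be represented. -/
theorem termRep_of_outIsFinsetSumOn {s : ℕ → C.Dom → Finset ι} (hout : OutIsFinsetSumOn M T s K W) :
    TermRep M K T W := by
  intro k g hg U q hq X hX
  obtain ⟨hsum, hzero⟩ := hout k g hg U q hq X hX
  rw [hsum]
  exact hasSum_sum_of_ne_finset_zero hzero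

/-- [folklore] A finite expansion is also an unconditional series: `OutIsFinsetSumOn ⟹ OutIsSeriesOn` (`Finset.tsum_eq_sum` form
`tsum_eq_sum`). -/
theorem outIsSeriesOn_of_outIsFinsetSumOn {s : ℕ → C.Dom → Finset ι} (hout : OutIsFinsetSumOn M T s K W) :
    OutIsSeriesOn M T K W :=
  outIsSeriesOn_of_termRep (termRep_of_outIsFinsetSumOn hout)

/-- [folklore] `[Fintype ι]`: «`Out` = the sum of ALL terms» on the class ⟹ `TermRep` (`hasSum_fintype`). -/
theorem termRep_of_outIsSumOn [Fintype ι]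
    (hout : ∀ k, ∀ g ∈ W, ∀ (U : C.BgB) (q : Op × Hist), q ∈ K k g U → ∀ X : C.Dom, C.scale X = k →
      M.Out k q.1 q.2 X = ∑ i, T k i q.1 q.2 X) :
    TermRep M K T W := by
  intro k g hg U q hq X hX
  rw [hout k g hg U q hq X hX]
  exact hasSum_fintype _

end Finite

/-! ## §4 Composition BY NAME with the landed closures of the termwise leaf -/

section Composition

variable {M : StepModel C Op Hist} {T : ℕ → ι → Op → Hist → C.Dom → ℂ}
  {K : ℕ → (ℕ → ℝ) → C.BgB → Set (Op × Hist)} {W : Set (ℕ → ℝ)}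

/-- [folklore] **SERIES ⟹ CLASS BOUND**: `OutIsSeriesOn ∧ TermBound κ a ∧ TermBudget a G ⟹ ClassBound M K W κ G`
(`T4InputCauchyRateTermwise.classBound_of_termwise` with `hrep` discharged by §2). -/
theorem classBound_of_outIsSeriesOn {κ G : ℝ} {a : ℕ → ι → ℝ} (hout : OutIsSeriesOn M T K W)
    (hbd : TermBound K T W κ a) (hbud : TermBudget a G) : ClassBound M K W κ G :=
  classBound_of_termwise (termRep_of_outIsSeriesOn_budget hout hbd hbud) hbd hbud

variable (M T) in
/-- [folklore] **END FACE, `hrep` DISCHARGED** — `T4InputCauchyRateTermwise.ne5_at_of_stepModel_termwise_slack_budget_scale_nat`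
(NE5 from budget and termwise data on the undilated ball class, no room) with its binder `hrep : TermRep M (ballClass ctr ROp
RHist) T W` replaced by the identification `OutIsSeriesOn M T (ballClass ctr ROp RHist) W` (what `Out := ∑' i, T k i` gives by
`rfl`); EVERY OTHER BINDER BY NAME AND UNCHANGED — representation of the two runs, admissibility of run B's data, `BaseBudget`,
the two room inequalities, `TermBound`∕`TermBudget`∕`TermLineAnalytic` on the ball class, the one-run decay bounds, the rates,
the structural insertion shapes + `InsScaleBound`, near hypothesis, first scales, smallness `ω + G·c/(1 − ρ₀) < θ′`; the SAME
constant.  Conclusion literally `T4OutputRate.NE5 EA EB W κ θ′ C₅`.  NOT a proof of NE5: every wall binder stays displayed. -/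
theorem ne5_at_of_stepModel_series_slack_budget_scale_nat {EA : Functional C C.BgA} {EB : Functional C C.BgB}
    {ctr : ℕ → (ℕ → ℝ) → C.BgB → Op × Hist} {BOp BHist ROp RHist : ℕ → ℝ} {a : ℕ → ι → ℝ}
    {κ G EA₀ E₀ E₁ δ δ' θ θ' c ω ρ₀ B : ℝ} {k₀ : ℕ} (hrA : M.RepresentsA EA W) (hrB : M.RepresentsB EB W)
    (hbase : M.InBase EB W) (hbudget : BaseBudget M W ctr BOp BHist) (hOp : ∀ k, BOp k + M.rOp k ≤ ROp k)
    (hHist : ∀ k, BHist k + M.rHist k ≤ RHist k) (hout : OutIsSeriesOn M T (ballClass ctr ROp RHist) W)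
    (hbd : TermBound (ballClass ctr ROp RHist) T W κ a) (hbud : TermBudget a G)
    (hline : TermLineAnalytic (ballClass ctr ROp RHist) T W) (hdA : DecayBound EA W EA₀ κ)
    (hdB : DecayBound EB W E₀ κ) (hop : M.OperatorRate W δ θ) (hins : M.InsertionRate W κ E₀ δ' θ)
    (haff : M.InsAffine W) (hblind : M.InsBlind W) (hhom : M.InsHomog W) (hunit : M.InsScaleBound W κ E₁ c ω)
    (hE₁ : 0 < E₁) (hG : 0 ≤ G) (hδ : 0 ≤ δ) (hδ' : 0 ≤ δ') (hθ : 0 ≤ θ) (hθθ' : θ ≤ θ') (hθ'1 : θ' ≤ 1) (hc : 0 ≤ c)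
    (hω : 0 < ω) (hρ₀ : ρ₀ < 1) (hnear : (δ + δ') * θ ^ k₀ + c * (EA₀ + E₀) / (1 - ω) ≤ ρ₀) (hB : 0 ≤ B)
    (hfirst : ∀ k < k₀, EA₀ + E₀ ≤ B * θ ^ k) (hsmall : ω + G / (1 - ρ₀) * c < θ') :
    NE5 EA EB W κ θ' ((G / (1 - ρ₀) * δ + G / (1 - ρ₀) * δ' + B) * (θ' - ω) / (θ' - (ω + G / (1 - ρ₀) * c))) :=
  ne5_at_of_stepModel_termwise_slack_budget_scale_nat M T hrA hrB hbase hbudget hOp hHist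
    (termRep_of_outIsSeriesOn_budget hout hbd hbud) hbd hbud hline hdA hdB hop hins haff hblind hhom hunit hE₁ hG hδ hδ'
    hθ hθθ' hθ'1 hc hω hρ₀ hnear hB hfirst hsmall

end Composition

/-! ## §5 Consistency check on the termwise leaf's toy: an infinite expansion where `OutIsSeries` holds and §2 re-derives
## the leaf's `TermRep` from the leaf's own majorant -/

section Toy

open Literature.MathematicalPhysics.QuantumFieldTheory.Balaban1983to89.T4InputCauchyRateSpecies (toyCtr)
open Literature.MathematicalPhysics.QuantumFieldTheory.Balaban1983to89.T4InputCauchyRateTermwise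
  (toyModelER toyTermE toyMajE hasSum_expSeries_sub_one toyE_termBound toyE_termBudget toyE_termRep)

/-- [folklore] The termwise toy's output `exp(o + h) − 1` IS the series of its Taylor terms `(o + h)^{i+1}/(i+1)!`, at every
point (`hasSum_expSeries_sub_one`, read as a `tsum` identity): `OutIsSeries toyModelER toyTermE`. -/
theorem toyER_outIsSeries : OutIsSeries toyModelER toyTermE := fun _ o h _ =>
  ((hasSum_expSeries_sub_one (o + h)).tsum_eq).symm

/-- [folklore] CONSISTENCY (an `example`, since the statement IS the leaf's landed `toyE_termRep` — dedup): the leaf's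
`toyE_termRep` (proved there directly from the exponential series) is re-derived by the generic d3 theorem from `OutIsSeries`
and the leaf's OWN displayed majorant (`toyE_termBound`, `toyE_termBudget` on the ball class of radii `(5/32, 9/4)`). -/
example : TermRep toyModelER (ballClass toyCtr (fun _ => 5 / 32) fun _ => 9 / 4) toyTermE Set.univ :=
  termRep_of_outIsSeries_budget toyER_outIsSeries toyE_termBound toyE_termBudget

/-- [folklore] … and the two proofs prove the same statement (the check that the STATEMENTS coincide, by `rfl` on the type). -/
example : (termRep_of_outIsSeries_budget toyER_outIsSeries toyE_termBound toyE_termBudget :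
    TermRep toyModelER (ballClass toyCtr (fun _ => 5 / 32) fun _ => 9 / 4) toyTermE Set.univ) = toyE_termRep := rfl

end Toy

end Summit.QuantumFields.BalabanUV.T4Continuum.TermRepOfSeries

/-! ## §6 (file v1.1, ADDITIVE) POINTWISE and X-DEPENDENT majorants.  Row O1-d1's design finding (leaf-02, journal l.5621):
## the leaf's `TermBound K T W κ a` ∕ `TermBudget a G` carry X-BLIND weights `a k i`, so with ABSOLUTE term labels (a label
## localizes at exactly one output domain) `Σ_i a k i` runs over the labels of ALL step-`k` domains and is volume-extensive.
## `TermRep` itself needs only summability AT EACH CLASS POINT AND DOMAIN; so d3 is stated here (i) from pointwise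
## summability, (ii) from an X-DEPENDENT displayed majorant `a k X i` (inline binder, no new shape minted), and (iii) the
## class bound `ClassBound M K W κ G` from an X-dependent majorant with a PER-DOMAIN budget `Σ_i a k X i ≤ G` — the form in
## which [Balaban1988RG2Cluster] (2.41) p. 21 is printed (a bound PER X; locator only).  Either remedy of l.5621 (R1 anchor
## re-coding, `B13StepTermLabels.Coding.termRep_lift`; R2 X-dependent budget) then meets d3 BY NAME. -/

namespace Summit.QuantumFields.BalabanUV.T4Continuum.TermRepOfSeries

open scoped BigOperators

open Literature.MathematicalPhysics.QuantumFieldTheory.Balaban1983to89.T4OutputRate (Carriers)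
open Literature.MathematicalPhysics.QuantumFieldTheory.Balaban1983to89.T4InputCauchyRateData (StepModel)
open Literature.MathematicalPhysics.QuantumFieldTheory.Balaban1983to89.T4InputCauchyRateSpecies (ClassBound)
open Literature.MathematicalPhysics.QuantumFieldTheory.Balaban1983to89.T4InputCauchyRateTermwise (TermRep TermBound)

section Pointwise

variable {C : Carriers} {Op Hist : Type*} [NormedAddCommGroup Op] [NormedSpace ℂ Op] [NormedAddCommGroup Hist]
  [NormedSpace ℂ Hist] {ι : Type*} {M : StepModel C Op Hist} {T : ℕ → ι → Op → Hist → C.Dom → ℂ}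
  {K : ℕ → (ℕ → ℝ) → C.BgB → Set (Op × Hist)} {W : Set (ℕ → ℝ)}

/-- [folklore] **ROW O1-d3, WEAKEST FORM**: the identification on the class plus POINTWISE summability of the term family at
every class point and step-`k` domain give `TermRep M K T W` (`Summable.hasSum`).  Every majorant form below factors through
this one. -/
theorem termRep_of_outIsSeriesOn_summable (hout : OutIsSeriesOn M T K W)
    (hsum : ∀ k, ∀ g ∈ W, ∀ (U : C.BgB) (q : Op × Hist), q ∈ K k g U → ∀ X : C.Dom, C.scale X = k →
      Summable fun i => T k i q.1 q.2 X) :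
    TermRep M K T W := by
  intro k g hg U q hq X hX
  rw [hout k g hg U q hq X hX]
  exact (hsum k g hg U q hq X hX).hasSum

omit [NormedAddCommGroup Op] [NormedSpace ℂ Op] [NormedAddCommGroup Hist] [NormedSpace ℂ Hist] in
/-- [folklore] COMPARISON TEST with an X-DEPENDENT majorant: `‖T k i q.1 q.2 X‖ ≤ a k X i · e^{−κd(X)}` with `Summable (a k X)`
gives summability of the terms at that class point and domain. -/
theorem summable_terms_of_boundAt {κ : ℝ} {a : ℕ → C.Dom → ι → ℝ}
    (hbd : ∀ k, ∀ g ∈ W, ∀ (U : C.BgB) (q : Op × Hist), q ∈ K k g U → ∀ X : C.Dom, C.scale X = k →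
      ∀ i, ‖T k i q.1 q.2 X‖ ≤ a k X i * Real.exp (-(κ * C.d X)))
    (ha : ∀ (k : ℕ) (X : C.Dom), C.scale X = k → Summable (a k X)) {k : ℕ} {g : ℕ → ℝ} (hg : g ∈ W) (U : C.BgB)
    {q : Op × Hist} (hq : q ∈ K k g U) {X : C.Dom} (hX : C.scale X = k) : Summable fun i => T k i q.1 q.2 X :=
  Summable.of_norm_bounded ((ha k X hX).mul_right (Real.exp (-(κ * C.d X)))) fun i => hbd k g hg U q hq X hX i

/-- [folklore] **ROW O1-d3 FROM AN X-DEPENDENT DISPLAYED MAJORANT**: identification on the class + `‖T k i q.1 q.2 X‖ ≤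
a k X i · e^{−κd(X)}` with `Summable (a k X)` at every step-`k` domain ⟹ `TermRep M K T W`.  (The X-blind `TermBound K T W κ a`
of the leaf is the case `a k X i := a k i`, `termRep_of_outIsSeriesOn`.) -/
theorem termRep_of_outIsSeriesOn_boundAt {κ : ℝ} {a : ℕ → C.Dom → ι → ℝ} (hout : OutIsSeriesOn M T K W)
    (hbd : ∀ k, ∀ g ∈ W, ∀ (U : C.BgB) (q : Op × Hist), q ∈ K k g U → ∀ X : C.Dom, C.scale X = k →
      ∀ i, ‖T k i q.1 q.2 X‖ ≤ a k X i * Real.exp (-(κ * C.d X)))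
    (ha : ∀ (k : ℕ) (X : C.Dom), C.scale X = k → Summable (a k X)) : TermRep M K T W :=
  termRep_of_outIsSeriesOn_summable hout fun _ _ hg U _ hq _ hX => summable_terms_of_boundAt hbd ha hg U hq hX

omit [NormedAddCommGroup Op] [NormedSpace ℂ Op] [NormedAddCommGroup Hist] [NormedSpace ℂ Hist] in
/-- [folklore] The leaf's X-blind `TermBound K T W κ a` IS an X-dependent majorant with constant-in-X weights (dictionary). -/
theorem boundAt_of_termBound {κ : ℝ} {a : ℕ → ι → ℝ} (hbd : TermBound K T W κ a) :
    ∀ k, ∀ g ∈ W, ∀ (U : C.BgB) (q : Op × Hist), q ∈ K k g U → ∀ X : C.Dom, C.scale X = k →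
      ∀ i, ‖T k i q.1 q.2 X‖ ≤ (fun k (_ : C.Dom) i => a k i) k X i * Real.exp (-(κ * C.d X)) :=
  hbd

/-- [folklore] **CLASS BOUND FROM `TermRep` AND AN X-DEPENDENT MAJORANT WITH A PER-DOMAIN BUDGET** — the X-dependent twin of
`T4InputCauchyRateTermwise.classBound_of_termwise`: `TermRep M K T W`, `‖T k i q.1 q.2 X‖ ≤ a k X i · e^{−κd(X)}` and
`Summable (a k X) ∧ ∑' i, a k X i ≤ G` at every step-`k` domain ⟹ `ClassBound M K W κ G` (`HasSum.norm_le_of_bounded`, per X —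
the proof never mixes domains).  Printed SUPPORT for the per-domain form: [Balaban1988RG2Cluster] (2.41) p. 21 bounds
`|𝐄^{(k+1)}(X)|` FOR EACH X (locator only; nothing asserted about Bałaban's terms). -/
theorem classBound_of_termRep_boundAt {κ G : ℝ} {a : ℕ → C.Dom → ι → ℝ} (hrep : TermRep M K T W)
    (hbd : ∀ k, ∀ g ∈ W, ∀ (U : C.BgB) (q : Op × Hist), q ∈ K k g U → ∀ X : C.Dom, C.scale X = k →
      ∀ i, ‖T k i q.1 q.2 X‖ ≤ a k X i * Real.exp (-(κ * C.d X)))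
    (hbud : ∀ (k : ℕ) (X : C.Dom), C.scale X = k → Summable (a k X) ∧ ∑' i, a k X i ≤ G) :
    ClassBound M K W κ G := by
  intro k g hg U q hq X hX
  obtain ⟨hs, hG⟩ := hbud k X hX
  have h1 : ‖M.Out k q.1 q.2 X‖ ≤ (∑' i, a k X i) * Real.exp (-(κ * C.d X)) :=
    (hrep k g hg U q hq X hX).norm_le_of_bounded (hs.hasSum.mul_right _) (hbd k g hg U q hq X hX)
  exact h1.trans (mul_le_mul_of_nonneg_right hG (Real.exp_pos _).le)

/-- [folklore] **CLASS BOUND FROM THE IDENTIFICATION AND AN X-DEPENDENT MAJORANT WITH A PER-DOMAIN BUDGET**: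
`OutIsSeriesOn ∧ (X-dependent majorant) ∧ (per-domain budget ≤ G) ⟹ ClassBound M K W κ G`. -/
theorem classBound_of_outIsSeriesOn_boundAt {κ G : ℝ} {a : ℕ → C.Dom → ι → ℝ} (hout : OutIsSeriesOn M T K W)
    (hbd : ∀ k, ∀ g ∈ W, ∀ (U : C.BgB) (q : Op × Hist), q ∈ K k g U → ∀ X : C.Dom, C.scale X = k →
      ∀ i, ‖T k i q.1 q.2 X‖ ≤ a k X i * Real.exp (-(κ * C.d X)))
    (hbud : ∀ (k : ℕ) (X : C.Dom), C.scale X = k → Summable (a k X) ∧ ∑' i, a k X i ≤ G) :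
    ClassBound M K W κ G :=
  classBound_of_termRep_boundAt (termRep_of_outIsSeriesOn_boundAt hout hbd fun k X hX => (hbud k X hX).1) hbd hbud

end Pointwise

end Summit.QuantumFields.BalabanUV.T4Continuum.TermRepOfSeries
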